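/-
Copyright (c) 2026. All rights reserved.
Released under Apache 2.0 license as described in the file LICENSE.
-/
import Mathlib
import HarnessLib
import Literature.Topology.FourManifolds.TubeFramings
import Literature.Topology.FourManifolds.InteriorTangent
import Literature.Topology.FourManifolds.LevelPassageSurgery

/-!
# The framing class of the attaching circle of an index-2 critical point

Topic `Literature/Topology/FourManifolds`. Fourth module (after `GLLoopClasses.lean`,
`StableFramesAlongDiscs.lean`, `TubeFramings.lean`) of the proof of the twisted-framing exclusion
in the middle-level fact
`Literature.Topology.FourManifolds.exists_middleLevel_isStabilization_of_isHCobordism`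
(R. Kirby, *The topology of 4-manifolds*, LNM 1374 (1989), Ch. X, p. 55: *"The framing is zero in
`π₁(SO(3)) = ℤ/2` because `W` is spin"*). For the passage of a critical point `q` of index `2` of a
Morse function on a `5`-dimensional cobordism (`Cobordism.PassageSetting`, `LevelPassageSurgery`:
the upper level is the circle surgery of the lower level `V` along the left-hand circle
`c_P = P.sphereEmb` with the tube `ν_P = P.circleNbhd`) we prove the **elementary form of Kirby's
remark**, with no reference to spin structures or characteristic classes:

* `Cobordism.PassageSetting.ob_eq_rotClass_iff` — for every disc `D` in the level `V` bounding
  the attaching circle, **the framing class `ob(ν_P, D) ∈ ℤ/2` (`TubeFramings.lean`) equals the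
  universal class `rotClass` iff the stable tangent bundle of the interior `W♭` of the cobordism
  is framed along the `2`-sphere `T_D = (ι' ∘ D) ∪ K`** glued from the disc (pushed to the level
  `b' = f q − ε²` along the trajectories) and the core disc `K` of `q` in its Milnor box.

The proof presents the level `b'` through the given presentation `ι : V → W` of the level `b` as
`ι' = π_{b'} ∘ ι` (§2: a smooth embedding onto the level `b'`, by the chain rule applied to
`π_b ∘ ι' = ι`; no derivative of the flow is needed) for which the tree's `levelProj_b'_ι_paramFwd`
gives `ι' ∘ ν_P = ψ ∘ paramVec ∘ squeeze` **exactly** (§4), so that the lifted stable tube frame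
(`ξ`; extra; `∂_θ`; `∂_w`) along the attaching circle is the push-forward by `Dψ` of an explicit
frame of box coordinates (§6 `liftedTubeFr_circlePoint`: the model field `-x⃗` of the box for
`ξ` by `MilnorBox.mfderiv_eq` and `D(coord) ∘ Dψ = id`, the derivative of
`H₀(θ, w) = paramVec(e^{iθ}, squeeze w)` on the zero section, §4), which **rotates with the angle**
(`boxFr_eq_rotFrame`). The class of a rotating frame against a constant one is the universal
`rotClass` (§1 `clsGL_eq_rotClass`: `[R_u A₀] = [R_u]·[A₀]` and `clsGL` is additive), the box frame
extends over the core disc, and the gluing criterion `StableFrames.framed_glue_iff` with the lift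
invariance `StableFrames.eClass_lift` (level `b'`, transverse field the cut-off gradient-like field,
transversality from `ξ(f) > 0`) conclude. §3 reads the Milnor box in the interior `W♭`
(`InteriorTangent.lean`): the box map `ψ` on the open set of centred coordinates of norm `< 3ε`
with value in `(0, 1)`, its smoothness and injective differential (`coord ∘ ψ = id`).

Everything is proved; no named facts are introduced.

## References

* R. C. Kirby, *The topology of 4-manifolds*, LNM 1374 (1989), Ch. X, p. 55. [Kirby1989]
* J. Milnor, *Lectures on the h-cobordism theorem* (1965), Def. 3.1, Def. 3.9, Thm. 3.13, Lemma 4.7.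
  [MilnorHCobordism1965]
* R. E. Gompf, A. I. Stipsicz, *4-Manifolds and Kirby Calculus*, GSM 20 (1999), §5.2 (`π₁ SO(3) = ℤ/2`,
  framings of circles), §5.7 (framings and `w₂`). [GompfStipsiczGSM1999]
-/

noncomputable section

open Set Function Metric Matrix Topology Bundle Module
open scoped Topology Manifold ContDiff Real

namespace Literature.Topology.FourManifolds

universe u

open StableFrames GLLoop

/-- Local notation: `𝔼 n` is the model Euclidean space `EuclideanSpace ℝ (Fin n)`. -/
local notation "𝔼 " n:arg => EuclideanSpace ℝ (Fin n)

/-- Local notation: the unit circle. -/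
local notation "𝕊¹" => (sphere (0 : EuclideanSpace ℝ (Fin (1 + 1))) 1)

/-- Local notation: the closed unit disc in the plane. -/
local notation "𝔻²" => StableFrames.UnitDisc2

/-- Local notation: the unit `2`-sphere. -/
local notation "𝕊²" => (sphere (0 : EuclideanSpace ℝ (Fin (2 + 1))) 1)

namespace StableFrames

/-! ### 1. Rotation of the first coordinate plane and the universal class `rotClass` -/

section Rot

variable {n : ℕ} (hn : 2 ≤ n)

/-- The index `0` of `Fin n` (`2 ≤ n`). [folklore] -/
def i0 : Fin n := ⟨0, by omega⟩

/-- The index `1` of `Fin n` (`2 ≤ n`). [folklore] -/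
def i1 : Fin n := ⟨1, by omega⟩

/-- The two indices differ. [folklore] -/
theorem i0_ne_i1 : i0 hn ≠ i1 hn := by simp [i0, i1, Fin.ext_iff]

/-- **The rotation of the `(x₀, x₁)`-coordinate plane of `ℝⁿ`** taking `e₀` to `(u₀, u₁, 0, …)`
and fixing the other coordinates, for `u ∈ 𝕊¹`. [folklore] -/
def rotE (u : 𝕊¹) : 𝔼 n →L[ℝ] 𝔼 n :=
  LinearMap.toContinuousLinearMap
    { toFun := fun v => WithLp.toLp 2 fun i : Fin n =>
        if i = i0 hn then u.1 0 * v (i0 hn) - u.1 1 * v (i1 hn)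
        else if i = i1 hn then u.1 1 * v (i0 hn) + u.1 0 * v (i1 hn) else v i
      map_add' := fun v w => by
        ext i
        simp only [PiLp.add_apply]
        split_ifs <;> ring
      map_smul' := fun c v => by
        ext i
        simp only [PiLp.smul_apply, smul_eq_mul, RingHom.id_apply]
        split_ifs <;> ring }

/-- Coordinates of `rotE`. [folklore] -/
theorem rotE_apply (u : 𝕊¹) (v : 𝔼 n) (i : Fin n) :
    rotE hn u v i = if i = i0 hn then u.1 0 * v (i0 hn) - u.1 1 * v (i1 hn)
      else if i = i1 hn then u.1 1 * v (i0 hn) + u.1 0 * v (i1 hn) else v i := rfl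

/-- The conjugate point `(u₀, -u₁)` of the circle. [folklore] -/
def conjPt (u : 𝕊¹) : 𝕊¹ :=
  ⟨WithLp.toLp 2 ![u.1 0, -(u.1 1)], by
    have h := circle_eq u
    rw [mem_sphere_zero_iff_norm, EuclideanSpace.norm_eq, Fin.sum_univ_two]
    simp only [Matrix.cons_val_zero, Matrix.cons_val_one, Real.norm_eq_abs, sq_abs, neg_sq, h, Real.sqrt_one]⟩

/-- First coordinate of the conjugate point. [folklore] -/
@[simp] theorem conjPt_apply_zero (u : 𝕊¹) : (conjPt u).1 0 = u.1 0 := rfl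

/-- Second coordinate of the conjugate point. [folklore] -/
@[simp] theorem conjPt_apply_one (u : 𝕊¹) : (conjPt u).1 1 = -(u.1 1) := rfl

/-- `rotE ū ∘ rotE u = id`. [folklore] -/
theorem rotE_conjPt_apply (u : 𝕊¹) (v : 𝔼 n) : rotE hn (conjPt u) (rotE hn u v) = v := by
  have h := circle_eq u
  have hne := i0_ne_i1 hn
  ext i
  simp only [rotE_apply, conjPt_apply_zero, conjPt_apply_one, if_neg hne.symm]
  split_ifs with h0 h1
  · subst h0; linear_combination v (i0 hn) * h
  · subst h1; linear_combination v (i1 hn) * h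
  · rfl

/-- `rotE u ∘ rotE ū = id`. [folklore] -/
theorem rotE_apply_conjPt (u : 𝕊¹) (v : 𝔼 n) : rotE hn u (rotE hn (conjPt u) v) = v := by
  have h := circle_eq u
  have hne := i0_ne_i1 hn
  ext i
  simp only [rotE_apply, conjPt_apply_zero, conjPt_apply_one, if_neg hne.symm]
  split_ifs with h0 h1
  · subst h0; linear_combination v (i0 hn) * h
  · subst h1; linear_combination v (i1 hn) * h
  · rfl

/-- The rotation as a linear automorphism of `ℝⁿ × ℝ` (identity on the extra direction).
[folklore] -/
def rotEquiv (u : 𝕊¹) : ((𝔼 n) × ℝ) ≃ₗ[ℝ] ((𝔼 n) × ℝ) where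
  toLinearMap := (rotE hn u).toLinearMap.prodMap LinearMap.id
  invFun := fun p => (rotE hn (conjPt u) p.1, p.2)
  left_inv := fun p => Prod.ext (rotE_conjPt_apply hn u p.1) rfl
  right_inv := fun p => Prod.ext (rotE_apply_conjPt hn u p.1) rfl

/-- **The rotated frame** `(R_u v_i, r_i)`. [folklore] -/
def rotFrame (u : 𝕊¹) (A : Fr n) : Fr n := fun i => (rotE hn u (A i).1, (A i).2)

/-- The rotated frame is the image under `rotEquiv`. [folklore] -/
theorem rotFrame_eq (u : 𝕊¹) (A : Fr n) : rotFrame hn u A = (rotEquiv hn u) ∘ A := by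
  funext i; rfl

/-- Rotated frames are frames. [folklore] -/
theorem linearIndependent_rotFrame (u : 𝕊¹) {A : Fr n} (hA : LinearIndependent ℝ A) :
    LinearIndependent ℝ (rotFrame hn u A) := by
  rw [rotFrame_eq]
  exact hA.map' (rotEquiv hn u).toLinearMap (rotEquiv hn u).ker

/-- `rotE` is continuous in `u` (jointly with the vector). [folklore] -/
theorem continuous_rotE_apply : Continuous fun p : 𝕊¹ × (𝔼 n) => rotE hn p.1 p.2 := by
  refine (PiLp.continuous_toLp 2 _).comp (continuous_pi fun i => ?_)
  have h0 : Continuous fun p : 𝕊¹ × (𝔼 n) => p.1.1 0 := (continuous_circle_coord 0).comp continuous_fst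
  have h1 : Continuous fun p : 𝕊¹ × (𝔼 n) => p.1.1 1 := (continuous_circle_coord 1).comp continuous_fst
  have hv : ∀ j : Fin n, Continuous fun p : 𝕊¹ × (𝔼 n) => p.2 j := fun j =>
    (PiLp.continuous_apply 2 _ j).comp continuous_snd
  change Continuous fun p : 𝕊¹ × (𝔼 n) => (if i = i0 hn then p.1.1 0 * p.2 (i0 hn) - p.1.1 1 * p.2 (i1 hn)
      else if i = i1 hn then p.1.1 1 * p.2 (i0 hn) + p.1.1 0 * p.2 (i1 hn) else p.2 i)
  split_ifs
  · exact (h0.mul (hv _)).sub (h1.mul (hv _))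
  · exact (h1.mul (hv _)).add (h0.mul (hv _))
  · exact hv i

/-- **The rotation loop** `u ↦ [R_u]` (the matrix of `rotEquiv u` in the standard stable basis),
a loop of invertible matrices. [folklore] -/
def rotGL : C(𝕊¹, NzMat (n + 1)) :=
  ⟨fun u => ⟨compMat (rotFrame hn u (stdB n)) (stdB n),
      det_compMat_ne_zero (linearIndependent_rotFrame hn u (stdB n).linearIndependent) (stdB n).linearIndependent⟩, by
    refine Continuous.subtype_mk ?_ _
    rw [← continuousOn_univ]
    refine continuousOn_compMat ?_ continuousOn_const fun _ _ => (stdB n).linearIndependent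
    refine (continuous_pi fun i => ?_).continuousOn
    exact ((continuous_rotE_apply hn).comp (continuous_id.prodMk continuous_const)).prodMk continuous_const⟩

/-- Values of the rotation loop. [folklore] -/
@[simp] theorem rotGL_apply_val (u : 𝕊¹) : (rotGL hn u).1 = compMat (rotFrame hn u (stdB n)) (stdB n) := rfl

/-- **Rotating a frame multiplies its coordinate matrix by the rotation loop**:
`[R_u A] = [R_u] · [A]` (in the standard stable basis). [folklore] -/
theorem compMat_rotFrame (u : 𝕊¹) (A : Fr n) :
    compMat (rotFrame hn u A) (stdB n) = (rotGL hn u).1 * compMat A (stdB n) := by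
  have hR := linearIndependent_rotFrame hn u (stdB n).linearIndependent
  rw [rotGL_apply_val, ← compMat_mul_compMat (A := rotFrame hn u A) hR (stdB n).linearIndependent]
  congr 1
  rw [rotFrame_eq, rotFrame_eq]
  exact compMat_map (rotEquiv hn u) (stdB n).linearIndependent

/-- **The universal class** `rotClass ∈ ℤ/2`: the class of the rotation loop of the first
coordinate plane (for the sizes used below this is the generator of `π₁ SO = ℤ/2`, but its value
is never needed). [cite: GompfStipsiczGSM1999, §5.2 (`π₁(SO(3)) ≅ ℤ₂`)] -/
def rotClass : ZMod 2 := clsGL (rotGL hn)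

/-- **Class of a rotating frame against a constant one.** If along a circle a frame is the
rotation `R_u A₀` of a fixed frame, then its comparison loop with the standard frame has class
`rotClass`. [folklore] -/
theorem clsGL_eq_rotClass (hn3 : 3 ≤ n + 1) {A₀ : Fr n} (hA₀ : LinearIndependent ℝ A₀) (L : C(𝕊¹, NzMat (n + 1)))
    (hL : ∀ u, (L u).1 = compMat (rotFrame hn u A₀) (stdB n)) : clsGL L = rotClass hn := by
  set C₀ : NzMat (n + 1) := ⟨compMat A₀ (stdB n), det_compMat_ne_zero hA₀ (stdB n).linearIndependent⟩
  have hmul : L = rotGL hn * ContinuousMap.const 𝕊¹ C₀ := by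
    ext u : 1; apply Subtype.ext
    rw [hL u, compMat_rotFrame]; rfl
  rw [hmul, clsGL_mul (by omega), clsGL_const, add_zero]; rfl

end Rot

end StableFrames

/-! ### 2. The level `b' = f q − ε²` presented through the given presentation of the level `b` -/

namespace Cobordism

namespace PassageSetting

open FourManifolds.Flow

variable {M N : Type u} [TopologicalSpace M] [ChartedSpace (𝔼 4) M] [TopologicalSpace N] [ChartedSpace (𝔼 4) N]
  {c : Cobordism 4 M N} {f : c.W → ℝ} {ξ : Π x : c.W, TangentSpace (𝓡∂ (4 + 1)) x}
  (P : PassageSetting c f ξ 1)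
  {V : Type u} [TopologicalSpace V] [ChartedSpace (𝔼 4) V]
  (ι : V → c.W) (hι : Manifold.IsSmoothEmbedding (𝓡 4) (𝓡∂ (4 + 1)) ∞ ι) (hιr : range ι = f ⁻¹' {P.b})

/-- The interior `W♭` of the cobordism. [folklore] -/
abbrev Wb (c : Cobordism 4 M N) : Type u := InteriorManifold (𝓡∂ (4 + 1)) c.W

/-- The cut-off gradient-like field of the setting (equal to `ξ` on the slab, in particular on
the levels `b`, `b'`; the Milnor box is a box for this field). [folklore] -/
abbrev fld : Π x : c.W, TangentSpace (𝓡∂ (4 + 1)) x := slabField f ξ P.a₀ P.a₁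

omit [TopologicalSpace V] [ChartedSpace (𝔼 4) V] in
include hιr in
/-- Points of `V` lie on the level `b`. [folklore] -/
theorem apply_ι (v : V) : f (ι v) = P.b := by
  have : ι v ∈ f ⁻¹' {P.b} := hιr ▸ mem_range_self v
  simpa using this

/-- **The presentation `ι' = π_{b'} ∘ ι` of the level `b'`**: follow the trajectory of a point of
the level `b` up to the level `b' = f q − ε²`. [cite: MilnorHCobordism1965, Lemma 4.7 (PDF p. 25)] -/
def upEmb (v : V) : c.W := Flow.levelProj P.θ f P.b' (ι v)

omit [TopologicalSpace V] [ChartedSpace (𝔼 4) V] in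
include hιr in
/-- `ι'` lands on the level `b'`. [folklore] -/
theorem apply_upEmb (v : V) : f (P.upEmb ι v) = P.b' :=
  apply_hittingTime (P.hits_b'_of_apply_eq_b (P.apply_ι ι hιr v))

omit [TopologicalSpace V] [ChartedSpace (𝔼 4) V] in
include hιr in
/-- `π_b ∘ ι' = ι`. [cite: MilnorHCobordism1965, Lemma 4.7 (PDF p. 25)] -/
theorem levelProj_b_upEmb (v : V) : Flow.levelProj P.θ f P.b (P.upEmb ι v) = ι v :=
  P.levelProj_b_levelProj_b' (P.apply_ι ι hιr v)

include hι hιr in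
/-- `ι'` is injective. [folklore] -/
theorem upEmb_injective : Injective (P.upEmb ι) := fun v w h => by
  have := congrArg (Flow.levelProj P.θ f P.b) h
  rw [P.levelProj_b_upEmb ι hιr, P.levelProj_b_upEmb ι hιr] at this
  exact hι.isEmbedding.injective this

omit [TopologicalSpace V] [ChartedSpace (𝔼 4) V] in
include hιr in
/-- `ι'` is onto the level `b'`. [folklore] -/
theorem range_upEmb : range (P.upEmb ι) = f ⁻¹' {P.b'} := by
  refine Subset.antisymm ?_ fun z hz => ?_
  · rintro _ ⟨v, rfl⟩; exact P.apply_upEmb ι hιr v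
  · have hz' : f z = P.b' := hz
    have hzb : f (Flow.levelProj P.θ f P.b z) = P.b := apply_hittingTime (P.hits_b_of_apply_eq_b' hz')
    obtain ⟨v, hv⟩ : Flow.levelProj P.θ f P.b z ∈ range ι := by rw [hιr]; exact hzb
    refine ⟨v, ?_⟩
    change Flow.levelProj P.θ f P.b' (ι v) = z
    rw [hv, P.levelProj_b'_levelProj_b hz']

include hι hιr in
/-- `ι'` is smooth. [cite: MilnorHCobordism1965, Thm. 4.1 (PDF p. 22)] -/
theorem contMDiff_upEmb : ContMDiff (𝓡 4) (𝓡∂ (4 + 1)) ∞ (P.upEmb ι) := fun v =>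
  (P.contMDiffAt_levelProj_b' (P.apply_ι ι hιr v)).comp v (hι.contMDiff v)

include hι hιr in
/-- **`ι'` has injective differential**: `D(π_b) ∘ Dι' = Dι` is injective. [folklore] -/
theorem mfderiv_upEmb_injective (v : V) : Injective (mfderiv (𝓡 4) (𝓡∂ (4 + 1)) (P.upEmb ι) v) := by
  have hn : (∞ : WithTop ℕ∞) ≠ 0 := by simp
  have h1 : HasMFDerivAt (𝓡 4) (𝓡∂ (4 + 1)) (Flow.levelProj P.θ f P.b ∘ P.upEmb ι) v
      ((mfderiv (𝓡∂ (4 + 1)) (𝓡∂ (4 + 1)) (Flow.levelProj P.θ f P.b) (P.upEmb ι v)).comp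
        (mfderiv (𝓡 4) (𝓡∂ (4 + 1)) (P.upEmb ι) v)) :=
    ((P.contMDiffAt_levelProj_b (P.apply_upEmb ι hιr v)).mdifferentiableAt hn).hasMFDerivAt.comp v
      ((P.contMDiff_upEmb ι hι hιr v).mdifferentiableAt hn).hasMFDerivAt
  have hfun : Flow.levelProj P.θ f P.b ∘ P.upEmb ι = ι := funext fun w => P.levelProj_b_upEmb ι hιr w
  rw [hfun] at h1
  have h2 := h1.mfderiv
  have hinj : Injective (mfderiv (𝓡 4) (𝓡∂ (4 + 1)) ι v) := mfderiv_injective_of_isImmersion hι.isImmersion (by simp) v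
  rw [h2] at hinj
  exact Injective.of_comp (f := fun x => (mfderiv (𝓡∂ (4 + 1)) (𝓡∂ (4 + 1)) (Flow.levelProj P.θ f P.b) (P.upEmb ι v)) x) hinj

omit [TopologicalSpace V] [ChartedSpace (𝔼 4) V] in
include hιr in
/-- Points of the level `b'` are interior points of the cobordism. [folklore] -/
theorem isInteriorPoint_upEmb (v : V) : (𝓡∂ (4 + 1)).IsInteriorPoint (P.upEmb ι v) :=
  P.slabFlow.isMorseFunction.isInteriorPoint_of_apply_mem_Ioo
    ⟨by rw [P.apply_upEmb ι hιr]; exact P.pre.pos.trans P.a₀_lt_b',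
      by rw [P.apply_upEmb ι hιr]; exact P.b'_lt_a₁.trans P.pre.lt_one⟩

/-- **`ι'` as a map into the interior `W♭`.** [folklore] -/
def upEmbI (v : V) : Wb c := ⟨P.upEmb ι v, P.isInteriorPoint_upEmb ι hιr v⟩

omit [TopologicalSpace V] [ChartedSpace (𝔼 4) V] in
/-- The underlying point of `upEmbI`. [folklore] -/
@[simp] theorem upEmbI_val (v : V) : (P.upEmbI ι hιr v).val = P.upEmb ι v := rfl

include hι in
/-- `upEmbI` is smooth. [folklore] -/
theorem contMDiff_upEmbI : ContMDiff (𝓡 4) (𝓡 (4 + 1)) ∞ (P.upEmbI ι hιr) :=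
  InteriorManifold.contMDiff_iff_comp_val.mpr (P.contMDiff_upEmb ι hι hιr)

include hι in
/-- `D upEmbI = D ι'` (the inclusion of the interior has identity differential). [folklore] -/
theorem mfderiv_upEmbI (v : V) :
    mfderiv (𝓡 4) (𝓡 (4 + 1)) (P.upEmbI ι hιr) v = mfderiv (𝓡 4) (𝓡∂ (4 + 1)) (P.upEmb ι) v := by
  have hn : (∞ : WithTop ℕ∞) ≠ 0 := by simp
  exact (InteriorManifold.mfderiv_comp_val ((P.contMDiff_upEmbI ι hι hιr v).mdifferentiableAt hn)).symm

include hι in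
/-- `upEmbI` has injective differential. [folklore] -/
theorem mfderiv_upEmbI_injective (v : V) : Injective (mfderiv (𝓡 4) (𝓡 (4 + 1)) (P.upEmbI ι hιr) v) := by
  rw [P.mfderiv_upEmbI ι hι hιr]; exact P.mfderiv_upEmb_injective ι hι hιr v

/-- **The field read in the interior**: `X♭(y) = X(y)` (same tangent vector space). [folklore] -/
def fldI (y : Wb c) : 𝔼 (4 + 1) := P.fld y.val

include hι in
/-- The field is a continuous section of `TW♭` along `upEmbI`. [folklore] -/
theorem continuous_fldI_upEmbI :
    Continuous fun v => (TotalSpace.mk' (𝔼 (4 + 1)) (P.upEmbI ι hιr v) (P.fldI (P.upEmbI ι hιr v)) :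
      TangentBundle (𝓡 (4 + 1)) (Wb c)) := by
  rw [← continuousOn_univ, InteriorManifold.continuousOn_totalSpaceMk_iff (P.contMDiff_upEmbI ι hι hιr).continuous.continuousOn,
    continuousOn_univ]
  exact P.pre.contMDiff_slabField.continuous.comp (P.contMDiff_upEmb ι hι hιr).continuous

include hι hιr in
/-- **The field is transverse to the level `b'`**: `X(f) > 0` on the level while `D(f ∘ ι') = 0`.
[cite: MilnorHCobordism1965, Def. 3.1 (1)] -/
theorem fldI_not_mem_range (v : V) :
    P.fldI (P.upEmbI ι hιr v) ∉ LinearMap.range (mfderiv (𝓡 4) (𝓡 (4 + 1)) (P.upEmbI ι hιr) v).toLinearMap := by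
  rintro ⟨w, hw⟩
  have hn : (∞ : WithTop ℕ∞) ≠ 0 := by simp
  have hpos := P.transversal_b' _ (P.apply_upEmb ι hιr v)
  -- `Df (Dι' w) = D(f ∘ ι') w = 0`
  have hcomp : HasMFDerivAt (𝓡 4) 𝓘(ℝ, ℝ) (f ∘ P.upEmb ι) v
      ((mfderiv (𝓡∂ (4 + 1)) 𝓘(ℝ, ℝ) f (P.upEmb ι v)).comp (mfderiv (𝓡 4) (𝓡∂ (4 + 1)) (P.upEmb ι) v)) :=
    (P.mdifferentiable_f _).hasMFDerivAt.comp v ((P.contMDiff_upEmb ι hι hιr v).mdifferentiableAt hn).hasMFDerivAt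
  have hconst : f ∘ P.upEmb ι = fun _ => P.b' := funext fun w => P.apply_upEmb ι hιr w
  rw [hconst] at hcomp
  have hzero : HasMFDerivAt (𝓡 4) 𝓘(ℝ, ℝ) (fun _ : V => P.b') v (0 : TangentSpace (𝓡 4) v →L[ℝ] ℝ) :=
    hasMFDerivAt_const P.b' v
  have heq := hcomp.mfderiv.symm.trans hzero.mfderiv
  have hw' : mfderiv (𝓡 4) (𝓡∂ (4 + 1)) (P.upEmb ι) v w = P.fld (P.upEmb ι v) := by
    rw [← P.mfderiv_upEmbI ι hι hιr]; exact hw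
  have h0 : mfderiv (𝓡∂ (4 + 1)) 𝓘(ℝ, ℝ) f (P.upEmb ι v) (mfderiv (𝓡 4) (𝓡∂ (4 + 1)) (P.upEmb ι) v w) = 0 :=
    congrArg (fun T : TangentSpace (𝓡 4) v →L[ℝ] ℝ => T w) heq
  rw [hw'] at h0
  exact hpos.ne' h0

/-! ### 3. The Milnor box read in the interior -/

omit P in
/-- A one-sided inverse of an endomorphism of a finite-dimensional space is two-sided. [folklore] -/
theorem comp_eq_id_comm {E : Type*} [NormedAddCommGroup E] [NormedSpace ℝ E] [FiniteDimensional ℝ E]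
    {A B : E →L[ℝ] E} (h : A.comp B = ContinuousLinearMap.id ℝ E) : B.comp A = ContinuousLinearMap.id ℝ E := by
  have h1 : (A : E →ₗ[ℝ] E) * (B : E →ₗ[ℝ] E) = 1 := by
    ext v
    exact congrArg (fun T : E →L[ℝ] E => T v) h
  have h2 : (B : E →ₗ[ℝ] E) * (A : E →ₗ[ℝ] E) = 1 := mul_eq_one_comm.mp h1
  ext v
  exact congrArg (fun T : E →ₗ[ℝ] E => T v) h2

/-- **The domain of the box map**: centred coordinates of norm `< 3ε` whose chart point has value
in `(0, 1)` (hence is an interior point); open, and it contains the core disc and the level-`b'`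
tube near the core circle. [folklore] -/
def boxDom : Set (𝔼 (4 + 1)) := ball 0 (3 * P.ε) ∩ {w | f (P.chartPoint w) ∈ Ioo (0 : ℝ) 1}

/-- The box domain is open. [folklore] -/
theorem isOpen_boxDom : IsOpen P.boxDom := by
  have hc : ContinuousOn (fun w => f (P.chartPoint w)) (ball (0 : 𝔼 (4 + 1)) (3 * P.ε)) := fun w hw =>
    ((P.contMDiff_f.contMDiffAt).comp w (P.contMDiffAt_chartPoint (mem_ball_zero_iff.mp hw))).continuousAt.continuousWithinAt
  exact hc.isOpen_inter_preimage isOpen_ball isOpen_Ioo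

/-- Points of the box domain have small norm. [folklore] -/
theorem norm_lt_of_mem_boxDom {w : 𝔼 (4 + 1)} (hw : w ∈ P.boxDom) : ‖w‖ < 3 * P.ε := mem_ball_zero_iff.mp hw.1

/-- The critical point is interior. [folklore] -/
theorem isInteriorPoint_q : (𝓡∂ (4 + 1)).IsInteriorPoint P.q :=
  P.slabFlow.isMorseFunction.isInteriorPoint_of_apply_mem_Ioo
    ⟨P.pre.pos.trans (P.a₀_lt_b'.trans P.b'_lt), P.apply_le.trans_lt P.pre.lt_one⟩

open Classical in
/-- **The box map into the interior** `w ↦ ψ(w) = φ̂⁻¹(φ̂ q + w)` on the box domain (junk value `q`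
outside). [cite: MilnorHCobordism1965, Def. 3.1 (2) (PDF p. 12)] -/
def boxMapI (w : 𝔼 (4 + 1)) : Wb c :=
  if hw : w ∈ P.boxDom then ⟨P.chartPoint w, P.slabFlow.isMorseFunction.isInteriorPoint_of_apply_mem_Ioo hw.2⟩
  else ⟨P.q, P.isInteriorPoint_q⟩

/-- On the box domain the box map is the chart point. [folklore] -/
theorem boxMapI_val {w : 𝔼 (4 + 1)} (hw : w ∈ P.boxDom) : (P.boxMapI w).val = P.chartPoint w := by
  rw [boxMapI, dif_pos hw]

/-- **The box map is smooth on the box domain.** [folklore] -/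
theorem contMDiffOn_boxMapI : ContMDiffOn (𝓡 (4 + 1)) (𝓡 (4 + 1)) ∞ P.boxMapI P.boxDom := by
  rw [InteriorManifold.contMDiffOn_iff_comp_val]
  refine ContMDiffOn.congr (f := P.chartPoint) (fun w hw => ?_) fun w hw => ?_
  · exact (P.contMDiffAt_chartPoint (P.norm_lt_of_mem_boxDom hw)).contMDiffWithinAt
  · exact P.boxMapI_val hw

/-- The box map is differentiable at points of the box domain. [folklore] -/
theorem mdifferentiableAt_boxMapI {w : 𝔼 (4 + 1)} (hw : w ∈ P.boxDom) :
    MDifferentiableAt (𝓡 (4 + 1)) (𝓡 (4 + 1)) P.boxMapI w :=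
  ((P.contMDiffOn_boxMapI w hw).contMDiffAt (P.isOpen_boxDom.mem_nhds hw)).mdifferentiableAt (by simp)

/-- Near a point of the box domain, `val ∘ boxMapI` is the chart point. [folklore] -/
theorem val_boxMapI_eventuallyEq {w : 𝔼 (4 + 1)} (hw : w ∈ P.boxDom) :
    (InteriorManifold.val ∘ P.boxMapI) =ᶠ[𝓝 w] P.chartPoint := by
  filter_upwards [P.isOpen_boxDom.mem_nhds hw] with w' hw'
  exact P.boxMapI_val hw'

/-- `D(boxMapI) = D(chartPoint)` on the box domain. [folklore] -/
theorem mfderiv_boxMapI {w : 𝔼 (4 + 1)} (hw : w ∈ P.boxDom) :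
    mfderiv (𝓡 (4 + 1)) (𝓡 (4 + 1)) P.boxMapI w = mfderiv (𝓡 (4 + 1)) (𝓡∂ (4 + 1)) P.chartPoint w := by
  rw [← InteriorManifold.mfderiv_comp_val (P.mdifferentiableAt_boxMapI hw)]
  exact (P.val_boxMapI_eventuallyEq hw).mfderiv_eq

/-- **`D(coord) ∘ D(chartPoint) = id`** on the box domain (`coord ∘ chartPoint = id` there).
[folklore] -/
theorem mfderiv_coord_comp_mfderiv_chartPoint {w : 𝔼 (4 + 1)} (hw : w ∈ P.boxDom) :
    (mfderiv (𝓡∂ (4 + 1)) 𝓘(ℝ, 𝔼 (4 + 1)) P.box.coord (P.chartPoint w)).comp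
      (mfderiv (𝓡 (4 + 1)) (𝓡∂ (4 + 1)) P.chartPoint w) = ContinuousLinearMap.id ℝ (𝔼 (4 + 1)) := by
  have hn : (∞ : WithTop ℕ∞) ≠ 0 := by simp
  have hlt := P.norm_lt_of_mem_boxDom hw
  have h1 : HasMFDerivAt (𝓡 (4 + 1)) 𝓘(ℝ, 𝔼 (4 + 1)) (P.box.coord ∘ P.chartPoint) w
      ((mfderiv (𝓡∂ (4 + 1)) 𝓘(ℝ, 𝔼 (4 + 1)) P.box.coord (P.chartPoint w)).comp
        (mfderiv (𝓡 (4 + 1)) (𝓡∂ (4 + 1)) P.chartPoint w)) :=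
    ((P.contMDiffAt_coord (P.chartPoint_mem_source hlt.le)).mdifferentiableAt hn).hasMFDerivAt.comp w
      ((P.contMDiffAt_chartPoint hlt).mdifferentiableAt hn).hasMFDerivAt
  have hev : (P.box.coord ∘ P.chartPoint) =ᶠ[𝓝 w] id := by
    filter_upwards [isOpen_ball.mem_nhds (mem_ball_zero_iff.mpr hlt)] with w' hw'
    exact P.coord_chartPoint (mem_ball_zero_iff.mp hw').le
  have h2 : HasMFDerivAt (𝓡 (4 + 1)) 𝓘(ℝ, 𝔼 (4 + 1)) (id : 𝔼 (4 + 1) → 𝔼 (4 + 1)) w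
      (ContinuousLinearMap.id ℝ (𝔼 (4 + 1))) := (hasFDerivAt_id w).hasMFDerivAt
  have h3 : mfderiv (𝓡 (4 + 1)) 𝓘(ℝ, 𝔼 (4 + 1)) (P.box.coord ∘ P.chartPoint) w =
      mfderiv (𝓡 (4 + 1)) 𝓘(ℝ, 𝔼 (4 + 1)) (id : 𝔼 (4 + 1) → 𝔼 (4 + 1)) w := hev.mfderiv_eq
  rw [h1.mfderiv, h2.mfderiv] at h3
  exact h3

/-- **The box map has injective differential** on the box domain. [folklore] -/
theorem mfderiv_boxMapI_injective {w : 𝔼 (4 + 1)} (hw : w ∈ P.boxDom) :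
    Injective (mfderiv (𝓡 (4 + 1)) (𝓡 (4 + 1)) P.boxMapI w) := by
  rw [P.mfderiv_boxMapI hw]
  have h := P.mfderiv_coord_comp_mfderiv_chartPoint hw
  have hinj : Injective ((mfderiv (𝓡∂ (4 + 1)) 𝓘(ℝ, 𝔼 (4 + 1)) P.box.coord (P.chartPoint w)).comp
      (mfderiv (𝓡 (4 + 1)) (𝓡∂ (4 + 1)) P.chartPoint w)) := by
    rw [h]; exact injective_id
  exact Injective.of_comp (f := fun x => (mfderiv (𝓡∂ (4 + 1)) 𝓘(ℝ, 𝔼 (4 + 1)) P.box.coord (P.chartPoint w)) x) hinj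

/-- **The field in box coordinates**: at a chart point `ψ(w)` of the box domain, the cut-off field is
the image under `D(chartPoint)` of Milnor's model field `(-x⃗, y⃗)` at `w`. [cite: MilnorHCobordism1965, Def. 3.1 (2), Lemma 3.2] -/
theorem fld_chartPoint {w : 𝔼 (4 + 1)} (hw : w ∈ P.boxDom) :
    P.fld (P.chartPoint w) = mfderiv (𝓡 (4 + 1)) (𝓡∂ (4 + 1)) P.chartPoint w (milnorModelField (1 + 1) w) := by
  have hlt := P.norm_lt_of_mem_boxDom hw
  have hsrc := P.chartPoint_mem_source hlt.le
  -- the box property: `D(φ̂)(X) = model (coord)`; and `D(coord) = D(φ̂)` (translation)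
  have hbox := P.box.mfderiv_eq _ hsrc
  rw [P.box_k] at hbox
  have hcoord : P.box.coord (P.chartPoint w) = w := P.coord_chartPoint hlt.le
  -- `D(coord)` as a map; `coord = extend - const`
  set A := mfderiv (𝓡∂ (4 + 1)) 𝓘(ℝ, 𝔼 (4 + 1)) P.box.coord (P.chartPoint w) with hA
  set B := mfderiv (𝓡 (4 + 1)) (𝓡∂ (4 + 1)) P.chartPoint w with hB
  have hAB : A.comp B = ContinuousLinearMap.id ℝ (𝔼 (4 + 1)) := P.mfderiv_coord_comp_mfderiv_chartPoint hw
  -- hence `B ∘ A = id` (finite dimension)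
  have hBA : B.comp A = ContinuousLinearMap.id ℝ (𝔼 (4 + 1)) :=
    comp_eq_id_comm (E := 𝔼 (4 + 1)) (A := A) (B := B) hAB
  -- `A (X) = D(extend)(X) = model w`
  have hAext : A = mfderiv (𝓡∂ (4 + 1)) 𝓘(ℝ, 𝔼 (4 + 1)) (P.box.chart.extend (𝓡∂ (4 + 1))) (P.chartPoint w) := by
    have hn : (∞ : WithTop ℕ∞) ≠ 0 := by simp
    have hn : (∞ : WithTop ℕ∞) ≠ 0 := by simp
    have hd : HasMFDerivAt (𝓡∂ (4 + 1)) 𝓘(ℝ, 𝔼 (4 + 1)) (P.box.chart.extend (𝓡∂ (4 + 1))) (P.chartPoint w)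
        (mfderiv (𝓡∂ (4 + 1)) 𝓘(ℝ, 𝔼 (4 + 1)) (P.box.chart.extend (𝓡∂ (4 + 1))) (P.chartPoint w)) :=
      ((P.box.chart.contMDiffAt_extend P.box.mem_maximalAtlas hsrc).mdifferentiableAt hn).hasMFDerivAt
    have hc : HasMFDerivAt (𝓡∂ (4 + 1)) 𝓘(ℝ, 𝔼 (4 + 1)) (fun _ : c.W => P.box.chart.extend (𝓡∂ (4 + 1)) P.q)
        (P.chartPoint w) (0 : TangentSpace (𝓡∂ (4 + 1)) (P.chartPoint w) →L[ℝ] 𝔼 (4 + 1)) :=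
      hasMFDerivAt_const _ _
    have hsub := hd.sub hc
    rw [sub_zero] at hsub
    exact hsub.mfderiv
  have hAX : A (P.fld (P.chartPoint w)) = milnorModelField (1 + 1) w := by
    have h' : milnorModelField (1 + 1) (P.box.chart.extend (𝓡∂ (4 + 1)) (P.chartPoint w) -
        P.box.chart.extend (𝓡∂ (4 + 1)) P.q) = milnorModelField (1 + 1) w := congrArg _ hcoord
    rw [hAext, ← h']; exact hbox
  have key := congrArg (fun T : 𝔼 (4 + 1) →L[ℝ] 𝔼 (4 + 1) => T (P.fld (P.chartPoint w))) hBA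
  change B (A (P.fld (P.chartPoint w))) = P.fld (P.chartPoint w) at key
  rw [hAX] at key
  exact key.symm

/-- **The standard stable frame of the box** pushed to `W♭`: `(Dψ(e₀), …, Dψ(e₄); extra)` along a
map `g = boxMapI ∘ g₀` into the box. [folklore] -/
theorem isStableFrameFieldOn_boxFrame {X : Type*} [TopologicalSpace X] {g₀ : X → 𝔼 (4 + 1)} (hg₀ : Continuous g₀)
    {R : Set X} (hR : MapsTo g₀ R P.boxDom) :
    IsStableFrameFieldOn (P.boxMapI ∘ g₀) (fun q => pushFr P.boxMapI (g₀ q) (stdB (4 + 1))) R :=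
  (isStableFrameFieldOn_const hg₀ (stdB (4 + 1)).linearIndependent R).pushOn P.isOpen_boxDom
    (P.contMDiffOn_boxMapI.of_le (by simp)) (fun _ hw => P.mfderiv_boxMapI_injective hw) hR

/-! ### 4. The tube of the left-hand circle read in the box at the level `b'` -/

section Tube

variable [Nonempty V] [IsManifold (𝓡 4) ∞ V]

/-- The tube of the setting is Milnor's `φ_L` precomposed with the squeeze. [folklore] -/
theorem circleNbhd_apply (σ : 𝕊¹) (w : 𝔼 3) :
    (P.circleNbhd ι hι hιr).toFun (σ, w) = P.paramFwd ι (σ, P.squeezeL w) := rfl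

include hιr in
/-- **The tube lifted to the level `b'` is the hyperboloid parametrisation in the box**:
`ι'(ν(σ, w)) = ψ(paramVec(σ, squeeze w))`. [cite: MilnorHCobordism1965, Def. 3.9 (PDF p. 16), Lemma 4.7] -/
theorem upEmb_circleNbhd (σ : 𝕊¹) (w : 𝔼 3) :
    P.upEmb ι ((P.circleNbhd ι hι hιr).toFun (σ, w)) = P.chartPoint (P.paramVec (σ, P.squeezeL w)) :=
  P.levelProj_b'_ι_paramFwd ι hιr (p := (σ, P.squeezeL w)) (P.norm_squeezeL_lt w)

include hιr in
/-- The attaching circle lifted to the level `b'` is the circle `ψ(ε σ, 0)` of the box. [folklore] -/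
theorem upEmb_sphereEmb (σ : 𝕊¹) :
    P.upEmb ι (P.sphereEmb ι hι hιr σ) = P.chartPoint (P.paramVec (σ, 0)) := by
  have h := P.upEmb_circleNbhd ι hι hιr σ 0
  rwa [(P.circleNbhd ι hι hιr).apply_zero, show P.squeezeL 0 = 0 from ballSqueeze_zero _ _] at h

/-- `paramVec (σ, 0) = (ε σ, 0)`. [folklore] -/
theorem paramVec_zero (σ : 𝕊¹) :
    P.paramVec (σ, 0) = lowerEmb (1 + 1) (4 + 1) (P.ε • (σ : EuclideanSpace ℝ (Fin (1 + 1)))) := by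
  rw [LeftSphereSetting.paramVec]
  simp only [norm_zero, ne_eq, OfNat.ofNat_ne_zero, not_false_eq_true, zero_pow, add_zero, map_zero]
  rw [Real.sqrt_sq P.eps_pos.le]

/-- **The hyperboloid parametrisation in the angle**: `H₀(θ, w) = paramVec(e^{iθ}, squeeze w)`.
[cite: MilnorHCobordism1965, Def. 3.9 (PDF p. 16)] -/
def H0 (p : ℝ × (𝔼 3)) : 𝔼 (4 + 1) := P.paramVec (circlePoint p.1, P.squeezeL p.2)

/-- The hyperboloid parametrisation lies in the box domain. [folklore] -/
theorem H0_mem_boxDom (p : ℝ × (𝔼 3)) : P.H0 p ∈ P.boxDom := by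
  have hsq := P.norm_sq_paramVec (circlePoint p.1, P.squeezeL p.2)
  have hlt := P.norm_squeezeL_lt p.2
  have hε := P.eps_pos
  have hnorm : ‖P.paramVec (circlePoint p.1, P.squeezeL p.2)‖ < 3 * P.ε := by
    have h3 : ‖P.paramVec (circlePoint p.1, P.squeezeL p.2)‖ ^ 2 < (3 * P.ε) ^ 2 := by
      rw [hsq]
      have : ‖P.squeezeL p.2‖ ^ 2 < P.ε ^ 2 := pow_lt_pow_left₀ hlt (norm_nonneg _) two_ne_zero
      nlinarith
    exact (pow_lt_pow_iff_left₀ (norm_nonneg _) (by linarith) two_ne_zero).mp h3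
  have hval : f (P.chartPoint (P.paramVec (circlePoint p.1, P.squeezeL p.2))) ∈ Ioo (0 : ℝ) 1 := by
    rw [P.apply_chartPoint_paramVec (p := (circlePoint p.1, P.squeezeL p.2)) hlt]
    exact ⟨P.pre.pos.trans P.a₀_lt_b', P.b'_lt_a₁.trans P.pre.lt_one⟩
  rw [boxDom, Set.mem_inter_iff, mem_ball_zero_iff, Set.mem_setOf_eq]
  exact ⟨hnorm, hval⟩

include hιr in
/-- **In `W♭`: `ι'♭ ∘ tubeMap = boxMapI ∘ H₀`.** [folklore] -/
theorem upEmbI_comp_tubeMap :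
    P.upEmbI ι hιr ∘ (P.circleNbhd ι hι hιr).tubeMap = P.boxMapI ∘ P.H0 := by
  funext p
  apply InteriorManifold.ext
  rw [Function.comp_apply, upEmbI_val, CircleNbhd.tubeMap, Function.comp_apply, P.boxMapI_val (P.H0_mem_boxDom p)]
  exact P.upEmb_circleNbhd ι hι hιr _ _

/-! #### The derivative of `H₀` on the zero section -/

/-- The circle as a curve in the plane. [folklore] -/
def cpVec (θ : ℝ) : EuclideanSpace ℝ (Fin (1 + 1)) := ((circlePoint θ : 𝕊¹) : EuclideanSpace ℝ (Fin (1 + 1)))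

/-- The velocity `(-sin θ, cos θ)` of the circle. [folklore] -/
def cpTan (θ : ℝ) : EuclideanSpace ℝ (Fin (1 + 1)) := WithLp.toLp 2 ![-Real.sin θ, Real.cos θ]

omit P in
/-- **The velocity of the circle.** [folklore] -/
theorem hasDerivAt_cpVec (θ : ℝ) : HasDerivAt cpVec (cpTan θ) θ := by
  have h : HasDerivAt (fun θ => ![Real.cos θ, Real.sin θ]) ![-Real.sin θ, Real.cos θ] θ := by
    rw [hasDerivAt_pi]
    intro i
    fin_cases i
    · simpa using Real.hasDerivAt_cos θ
    · simpa using Real.hasDerivAt_sin θ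
  have h2 := ((WithLp.linearEquiv 2 ℝ (Fin (1 + 1) → ℝ)).symm.toContinuousLinearEquiv.toContinuousLinearMap.hasFDerivAt).comp_hasDerivAt θ h
  exact h2

/-- **The squeeze has derivative `ε · cast` at the origin.** [folklore] -/
theorem hasFDerivAt_squeezeL_zero :
    HasFDerivAt P.squeezeL ((P.ε : ℝ) • (P.castL : EuclideanSpace ℝ (Fin (4 - 1 - 1 + 1)) →L[ℝ] EuclideanSpace ℝ (Fin (4 - 1)))) 0 := by
  have hfun : (P.squeezeL : EuclideanSpace ℝ (Fin (4 - 1 - 1 + 1)) → EuclideanSpace ℝ (Fin (4 - 1))) =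
      fun w => P.castL (P.ε • ((Real.sqrt (1 + ‖w‖ ^ 2))⁻¹ • w)) := by
    funext w; exact ballSqueeze_apply _ _ w
  rw [hfun]
  -- the scalar factor is differentiable at `0` (value `1`)
  have hg : DifferentiableAt ℝ (fun w : EuclideanSpace ℝ (Fin (4 - 1 - 1 + 1)) => (Real.sqrt (1 + ‖w‖ ^ 2))⁻¹) 0 := by
    have h1 : DifferentiableAt ℝ (fun w : EuclideanSpace ℝ (Fin (4 - 1 - 1 + 1)) => 1 + ‖w‖ ^ 2) 0 :=
      (differentiableAt_const _).add (differentiableAt_id.norm_sq ℝ)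
    have hpos : (0 : ℝ) < 1 + ‖(0 : EuclideanSpace ℝ (Fin (4 - 1 - 1 + 1)))‖ ^ 2 := by simp
    exact (h1.sqrt hpos.ne').inv (Real.sqrt_pos.mpr hpos).ne'
  have hsm : HasFDerivAt (fun w : EuclideanSpace ℝ (Fin (4 - 1 - 1 + 1)) => (Real.sqrt (1 + ‖w‖ ^ 2))⁻¹ • w)
      (ContinuousLinearMap.id ℝ _) 0 := by
    have h := hg.hasFDerivAt.smul (hasFDerivAt_id (0 : EuclideanSpace ℝ (Fin (4 - 1 - 1 + 1))))
    simp only [norm_zero, ne_eq, OfNat.ofNat_ne_zero, not_false_eq_true, zero_pow, add_zero, Real.sqrt_one, inv_one,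
      one_smul, id_eq, ContinuousLinearMap.smulRight_zero, add_zero] at h
    exact h
  have h2 : HasFDerivAt ((P.castL : EuclideanSpace ℝ (Fin (4 - 1 - 1 + 1)) → EuclideanSpace ℝ (Fin (4 - 1))) ∘
      fun w : EuclideanSpace ℝ (Fin (4 - 1 - 1 + 1)) => P.ε • ((Real.sqrt (1 + ‖w‖ ^ 2))⁻¹ • w))
      ((P.castL : EuclideanSpace ℝ (Fin (4 - 1 - 1 + 1)) →L[ℝ] EuclideanSpace ℝ (Fin (4 - 1))).comp
        (P.ε • ContinuousLinearMap.id ℝ (EuclideanSpace ℝ (Fin (4 - 1 - 1 + 1))))) 0 :=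
    HasFDerivAt.comp (0 : EuclideanSpace ℝ (Fin (4 - 1 - 1 + 1)))
      (P.castL : EuclideanSpace ℝ (Fin (4 - 1 - 1 + 1)) →L[ℝ] EuclideanSpace ℝ (Fin (4 - 1))).hasFDerivAt (hsm.const_smul P.ε)
  refine h2.congr_fderiv ?_
  ext v
  simp

/-- **The radius `√(ε² + ‖squeeze w‖²)` is stationary at the origin.** [folklore] -/
theorem hasFDerivAt_radius_zero :
    HasFDerivAt (fun w : EuclideanSpace ℝ (Fin (4 - 1 - 1 + 1)) => Real.sqrt (P.ε ^ 2 + ‖P.squeezeL w‖ ^ 2))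
      (0 : EuclideanSpace ℝ (Fin (4 - 1 - 1 + 1)) →L[ℝ] ℝ) 0 := by
  have h1 : HasFDerivAt (fun w : EuclideanSpace ℝ (Fin (4 - 1 - 1 + 1)) => P.ε ^ 2 + ‖P.squeezeL w‖ ^ 2)
      (0 : EuclideanSpace ℝ (Fin (4 - 1 - 1 + 1)) →L[ℝ] ℝ) 0 := by
    have h := (hasFDerivAt_const (P.ε ^ 2) (0 : EuclideanSpace ℝ (Fin (4 - 1 - 1 + 1)))).add
      (P.hasFDerivAt_squeezeL_zero.norm_sq)
    have h0 : P.squeezeL 0 = 0 := ballSqueeze_zero _ _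
    refine h.congr_fderiv ?_
    ext v; simp [h0]
  have hne : P.ε ^ 2 + ‖P.squeezeL 0‖ ^ 2 ≠ 0 := by have := P.eps_pos; positivity
  have h2 := h1.sqrt hne
  rwa [smul_zero] at h2

/-- **The derivative of `H₀` on the zero section**: there is a derivative `L` with
`L(1, 0) = (ε(-sin θ, cos θ), 0)` and `L(0, v) = (0, ε · cast v)`. [cite: MilnorHCobordism1965, Def. 3.9 (PDF p. 16)] -/
theorem exists_hasFDerivAt_H0 (θ : ℝ) : ∃ L : (ℝ × (𝔼 3)) →L[ℝ] 𝔼 (4 + 1), HasFDerivAt P.H0 L (θ, 0) ∧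
    L ((1 : ℝ), (0 : 𝔼 3)) = lowerEmb (1 + 1) (4 + 1) (P.ε • cpTan θ) ∧
      ∀ v : 𝔼 3, L ((0 : ℝ), v) = upperEmb (1 + 1) (4 - 1) (4 + 1) (P.ε • P.castL v) := by
  -- the radial factor, the circle, the squeeze, as functions of `(θ, w)`
  have hr : HasFDerivAt ((fun w : EuclideanSpace ℝ (Fin (4 - 1 - 1 + 1)) => Real.sqrt (P.ε ^ 2 + ‖P.squeezeL w‖ ^ 2)) ∘
      (Prod.snd : ℝ × (𝔼 3) → 𝔼 3))
      ((0 : EuclideanSpace ℝ (Fin (4 - 1 - 1 + 1)) →L[ℝ] ℝ).comp (ContinuousLinearMap.snd ℝ ℝ (𝔼 3))) (θ, 0) :=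
    HasFDerivAt.comp ((θ, 0) : ℝ × (𝔼 3)) P.hasFDerivAt_radius_zero hasFDerivAt_snd
  have hc : HasFDerivAt (cpVec ∘ (Prod.fst : ℝ × (𝔼 3) → ℝ))
      ((ContinuousLinearMap.smulRight (1 : ℝ →L[ℝ] ℝ) (cpTan θ)).comp (ContinuousLinearMap.fst ℝ ℝ (𝔼 3))) (θ, 0) :=
    HasFDerivAt.comp ((θ, 0) : ℝ × (𝔼 3)) (hasDerivAt_cpVec θ).hasFDerivAt hasFDerivAt_fst
  have hprod := hr.smul hc
  have hsq : HasFDerivAt ((P.squeezeL : EuclideanSpace ℝ (Fin (4 - 1 - 1 + 1)) → EuclideanSpace ℝ (Fin (4 - 1))) ∘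
      (Prod.snd : ℝ × (𝔼 3) → 𝔼 3))
      (((P.ε : ℝ) • (P.castL : EuclideanSpace ℝ (Fin (4 - 1 - 1 + 1)) →L[ℝ] EuclideanSpace ℝ (Fin (4 - 1)))).comp
        (ContinuousLinearMap.snd ℝ ℝ (𝔼 3))) (θ, 0) :=
    HasFDerivAt.comp ((θ, 0) : ℝ × (𝔼 3)) P.hasFDerivAt_squeezeL_zero hasFDerivAt_snd
  have hsum := (HasFDerivAt.comp ((θ, 0) : ℝ × (𝔼 3)) (lowerEmb (1 + 1) (4 + 1)).hasFDerivAt hprod).add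
    (HasFDerivAt.comp ((θ, 0) : ℝ × (𝔼 3)) (upperEmb (1 + 1) (4 - 1) (4 + 1)).hasFDerivAt hsq)
  have h0 : P.squeezeL 0 = 0 := ballSqueeze_zero _ _
  have hs0 : Real.sqrt (P.ε ^ 2 + ‖P.squeezeL 0‖ ^ 2) = P.ε := by
    rw [h0, norm_zero, zero_pow two_ne_zero, add_zero, Real.sqrt_sq P.eps_pos.le]
  refine ⟨_, hsum.congr_of_eventuallyEq (Filter.Eventually.of_forall fun p => rfl), ?_, fun v => ?_⟩
  · simp [hs0]
  · simp [h0]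

/-- **`∂_θ H₀ = (ε(-sin θ, cos θ), 0)`** on the zero section. [folklore] -/
theorem mfderiv_H0_one_zero (θ : ℝ) :
    mfderiv 𝓘(ℝ, ℝ × (𝔼 3)) (𝓡 (4 + 1)) P.H0 (θ, 0) ((1 : ℝ), (0 : 𝔼 3)) = lowerEmb (1 + 1) (4 + 1) (P.ε • cpTan θ) := by
  obtain ⟨L, hL, h1, -⟩ := P.exists_hasFDerivAt_H0 θ
  rw [hL.hasMFDerivAt.mfderiv]; exact h1

/-- **`∂_w H₀ · v = (0, ε · cast v)`** on the zero section. [folklore] -/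
theorem mfderiv_H0_zero (θ : ℝ) (v : 𝔼 3) :
    mfderiv 𝓘(ℝ, ℝ × (𝔼 3)) (𝓡 (4 + 1)) P.H0 (θ, 0) ((0 : ℝ), v) = upperEmb (1 + 1) (4 - 1) (4 + 1) (P.ε • P.castL v) := by
  obtain ⟨L, hL, -, h2⟩ := P.exists_hasFDerivAt_H0 θ
  rw [hL.hasMFDerivAt.mfderiv]; exact h2 v

/-- `H₀` is differentiable on the zero section. [folklore] -/
theorem mdifferentiableAt_H0 (θ : ℝ) : MDifferentiableAt 𝓘(ℝ, ℝ × (𝔼 3)) (𝓡 (4 + 1)) P.H0 (θ, 0) := by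
  obtain ⟨L, hL, -, -⟩ := P.exists_hasFDerivAt_H0 θ
  exact hL.hasMFDerivAt.mdifferentiableAt

end Tube

/-! ### 5. Coordinate identities in the box -/

section Coordinates

omit P

/-- `2 ≤ 4 + 1`. [folklore] -/
theorem two_le_five : 2 ≤ 4 + 1 := by norm_num

/-- The rotation takes `(a, 0, 0, 0, 0)` to `(a u₀, a u₁, 0, 0, 0)`. [folklore] -/
theorem rotE_lowerEmb_single_zero (u : 𝕊¹) (a : ℝ) :
    rotE two_le_five u (lowerEmb (1 + 1) (4 + 1) (EuclideanSpace.single 0 a)) =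
      lowerEmb (1 + 1) (4 + 1) (a • (u : EuclideanSpace ℝ (Fin (1 + 1)))) := by
  ext i
  simp only [rotE_apply, lowerEmb_apply, i0, i1, PiLp.smul_apply, smul_eq_mul]
  fin_cases i <;> simp [Fin.ext_iff] <;> ring

/-- The perpendicular `(-u₁, u₀)` of a point of the circle. [folklore] -/
def perpVec (u : 𝕊¹) : EuclideanSpace ℝ (Fin (1 + 1)) := WithLp.toLp 2 ![-(u.1 1), u.1 0]

/-- The rotation takes `(0, a, 0, 0, 0)` to `(-a u₁, a u₀, 0, 0, 0)`. [folklore] -/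
theorem rotE_lowerEmb_single_one (u : 𝕊¹) (a : ℝ) :
    rotE two_le_five u (lowerEmb (1 + 1) (4 + 1) (EuclideanSpace.single 1 a)) =
      lowerEmb (1 + 1) (4 + 1) (a • perpVec u) := by
  ext i
  simp only [rotE_apply, lowerEmb_apply, i0, i1, PiLp.smul_apply, smul_eq_mul, perpVec]
  fin_cases i <;> simp [Fin.ext_iff] <;> ring

/-- The rotation fixes the `y⃗`-coordinates. [folklore] -/
theorem rotE_upperEmb (u : 𝕊¹) (y : EuclideanSpace ℝ (Fin (4 - 1))) :
    rotE two_le_five u (upperEmb (1 + 1) (4 - 1) (4 + 1) y) = upperEmb (1 + 1) (4 - 1) (4 + 1) y := by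
  ext i
  simp only [rotE_apply, upperEmb_apply, i0, i1]
  fin_cases i <;> simp [Fin.ext_iff]

/-- The rotation fixes `0`-prefixed vectors of the extra direction (trivial). [folklore] -/
theorem rotE_zero (u : 𝕊¹) : rotE two_le_five u (0 : 𝔼 (4 + 1)) = 0 := map_zero _

/-- Milnor's model field of index `2` on the `x⃗`-plane is `-x⃗`. [cite: MilnorHCobordism1965, Def. 3.1] -/
theorem milnorModelField_lowerEmb (x : EuclideanSpace ℝ (Fin (1 + 1))) :
    milnorModelField (1 + 1) (lowerEmb (1 + 1) (4 + 1) x) = -lowerEmb (1 + 1) (4 + 1) x := by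
  ext i
  simp only [milnorModelField_apply, lowerEmb_apply, PiLp.neg_apply]
  fin_cases i <;> simp

/-- For `u = e^{iθ}`: `u = cpVec θ`. [folklore] -/
theorem coe_circlePoint (θ : ℝ) : ((circlePoint θ : 𝕊¹) : EuclideanSpace ℝ (Fin (1 + 1))) = cpVec θ := rfl

/-- For `u = e^{iθ}`: `perpVec u = cpTan θ`. [folklore] -/
theorem perpVec_circlePoint (θ : ℝ) : perpVec (circlePoint θ) = cpTan θ := by
  ext i
  fin_cases i <;> simp [perpVec, cpTan, circlePoint]

end Coordinates

/-! ### 6. The lifted tube frame in the box and the main theorem -/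

section Assembly

variable [Nonempty V] [IsManifold (𝓡 4) ∞ V]

/-- **The transverse field along `ι'`** (indexed by `V`): the cut-off gradient-like field at
`ι'(v)`. [folklore] -/
def xiV (v : V) : 𝔼 (4 + 1) := P.fld (P.upEmb ι v)

/-- **The lifted tube frame** `(X; extra, ∂_θ, ∂_w)` of `W♭` along the attaching circle lifted to
the level `b'`. [cite: Kirby1989, Ch. X p. 55] -/
def liftedTubeFr : 𝕊¹ → Fr (4 + 1) :=
  liftField (P.upEmbI ι hιr) (P.xiV ι) (G := P.sphereEmb ι hι hιr) (P.circleNbhd ι hι hιr).tubeFr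

/-- **The lifted tube frame is a stable frame field along `ι'♭ ∘ c_P`.** [folklore] -/
theorem isStableFrameFieldOn_liftedTubeFr :
    IsStableFrameFieldOn (P.upEmbI ι hιr ∘ P.sphereEmb ι hι hιr) (P.liftedTubeFr ι hι hιr) univ :=
  (P.circleNbhd ι hι hιr).isStableFrameFieldOn_tubeFr.lift (P.upEmbI ι hιr) (P.xiV ι)
    ((P.contMDiff_upEmbI ι hι hιr).of_le (by simp)) (P.mfderiv_upEmbI_injective ι hι hιr)
    (P.continuous_fldI_upEmbI ι hι hιr) (P.fldI_not_mem_range ι hι hιr)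

/-- The base point of the box coordinates of the attaching circle: `w₀(θ) = H₀(θ, 0) = (ε e^{iθ}, 0)`.
[folklore] -/
theorem H0_zero (θ : ℝ) : P.H0 (θ, 0) = lowerEmb (1 + 1) (4 + 1) (P.ε • cpVec θ) := by
  change P.paramVec (circlePoint θ, P.squeezeL 0) = _
  rw [show P.squeezeL 0 = 0 from ballSqueeze_zero _ _, paramVec_zero]; rfl

/-- **The box frame of the attaching circle** (in centred Milnor coordinates, to be pushed by
`Dψ`): the model field `-x⃗`, the extra direction, `∂_θ H₀`, `∂_w H₀`. [folklore] -/
def boxFr (θ : ℝ) : Fr (4 + 1) :=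
  Fin.cons (milnorModelField (1 + 1) (P.H0 (θ, 0)), 0) fun i =>
    (mfderiv 𝓘(ℝ, ℝ × (𝔼 3)) (𝓡 (4 + 1)) P.H0 (θ, 0) (CircleNbhd.dirVec i), CircleNbhd.dirR i)

/-- **The constant frame** rotated to give the box frame: `-ε e₀`, extra, `ε e₁`, `ε cast(e_j)` in
the `y⃗`-block. [folklore] -/
def boxFr₀ : Fr (4 + 1) :=
  Fin.cons (-lowerEmb (1 + 1) (4 + 1) (EuclideanSpace.single 0 P.ε), 0)
    (Fin.cons ((0 : 𝔼 (4 + 1)), (1 : ℝ))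
      (Fin.cons (lowerEmb (1 + 1) (4 + 1) (EuclideanSpace.single 1 P.ε), 0) fun j : Fin 3 =>
        (upperEmb (1 + 1) (4 - 1) (4 + 1) (P.ε • P.castL (EuclideanSpace.single j (1 : ℝ))), 0)))

/-- **The box frame rotates with the angle**: `boxFr θ = R_{e^{iθ}} boxFr₀`. [folklore] -/
theorem boxFr_eq_rotFrame (θ : ℝ) : P.boxFr θ = rotFrame two_le_five (circlePoint θ) P.boxFr₀ := by
  funext i
  refine Fin.cases ?_ (fun i' => ?_) i
  · -- the field slot
    simp only [boxFr, boxFr₀, Fin.cons_zero, rotFrame]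
    refine Prod.ext ?_ rfl
    change milnorModelField (1 + 1) (P.H0 (θ, 0)) = rotE two_le_five (circlePoint θ) (-lowerEmb (1 + 1) (4 + 1) (EuclideanSpace.single 0 P.ε))
    rw [H0_zero, milnorModelField_lowerEmb, map_neg, rotE_lowerEmb_single_zero, coe_circlePoint]
  · refine Fin.cases ?_ (fun i'' => ?_) i'
    · -- the extra slot
      simp only [boxFr, boxFr₀, Fin.cons_succ, Fin.cons_zero, rotFrame]
      refine Prod.ext ?_ rfl
      change mfderiv 𝓘(ℝ, ℝ × (𝔼 3)) (𝓡 (4 + 1)) P.H0 (θ, 0) (CircleNbhd.dirVec 0) = rotE two_le_five (circlePoint θ) 0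
      rw [CircleNbhd.dirVec_zero]
      exact ((mfderiv 𝓘(ℝ, ℝ × (𝔼 3)) (𝓡 (4 + 1)) P.H0 (θ, 0)).map_zero).trans (map_zero _).symm
    · refine Fin.cases ?_ (fun j => ?_) i''
      · -- the angle slot
        simp only [boxFr, boxFr₀, Fin.cons_succ, Fin.cons_zero, rotFrame]
        refine Prod.ext ?_ rfl
        change mfderiv 𝓘(ℝ, ℝ × (𝔼 3)) (𝓡 (4 + 1)) P.H0 (θ, 0) (CircleNbhd.dirVec 1) =
          rotE two_le_five (circlePoint θ) (lowerEmb (1 + 1) (4 + 1) (EuclideanSpace.single 1 P.ε))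
        rw [CircleNbhd.dirVec_one, mfderiv_H0_one_zero, rotE_lowerEmb_single_one, perpVec_circlePoint]
      · -- the fibre slots
        simp only [boxFr, boxFr₀, Fin.cons_succ, rotFrame]
        refine Prod.ext ?_ rfl
        change mfderiv 𝓘(ℝ, ℝ × (𝔼 3)) (𝓡 (4 + 1)) P.H0 (θ, 0) (CircleNbhd.dirVec j.succ.succ) =
          rotE two_le_five (circlePoint θ) (upperEmb (1 + 1) (4 - 1) (4 + 1) (P.ε • P.castL (EuclideanSpace.single j 1)))
        rw [CircleNbhd.dirVec_succ_succ, mfderiv_H0_zero, rotE_upperEmb]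

include hι in
/-- **The lifted tube frame is the box frame pushed by `Dψ`.** [cite: Kirby1989, Ch. X p. 55; MilnorHCobordism1965, Def. 3.9] -/
theorem liftedTubeFr_circlePoint (θ : ℝ) :
    P.liftedTubeFr ι hι hιr (circlePoint θ) = pushFr P.boxMapI (P.H0 (θ, 0)) (P.boxFr θ) := by
  have hn : (∞ : WithTop ℕ∞) ≠ 0 := by simp
  set ν := P.circleNbhd ι hι hιr with hν
  have hw₀ : P.H0 (θ, 0) ∈ P.boxDom := P.H0_mem_boxDom _
  have hpt : P.sphereEmb ι hι hιr (circlePoint θ) = ν.tubeMap (θ, 0) := (ν.tubeMap_zero θ).symm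
  have hup : P.upEmb ι (P.sphereEmb ι hι hιr (circlePoint θ)) = P.chartPoint (P.H0 (θ, 0)) := by
    rw [P.upEmb_sphereEmb ι hι hιr, H0_zero, paramVec_zero]; rfl
  funext i
  refine Fin.cases ?_ (fun i' => ?_) i
  · -- the field slot
    simp only [liftedTubeFr, liftField, liftFr_zero, boxFr, pushFr, Fin.cons_zero]
    refine Prod.ext ?_ rfl
    change P.fld (P.upEmb ι (P.sphereEmb ι hι hιr (circlePoint θ))) = mfderiv (𝓡 (4 + 1)) (𝓡 (4 + 1)) P.boxMapI (P.H0 (θ, 0))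
      (milnorModelField (1 + 1) (P.H0 (θ, 0)))
    rw [hup, P.fld_chartPoint hw₀, P.mfderiv_boxMapI hw₀]
    rfl
  · simp only [liftedTubeFr, liftField, liftFr_succ, boxFr, pushFr, Fin.cons_succ]
    refine Prod.ext ?_ ?_
    · change mfderiv (𝓡 4) (𝓡 (4 + 1)) (P.upEmbI ι hιr) (P.sphereEmb ι hι hιr (circlePoint θ)) (ν.tubeFr (circlePoint θ) i').1 =
        mfderiv (𝓡 (4 + 1)) (𝓡 (4 + 1)) P.boxMapI (P.H0 (θ, 0)) (mfderiv 𝓘(ℝ, ℝ × (𝔼 3)) (𝓡 (4 + 1)) P.H0 (θ, 0) (CircleNbhd.dirVec i'))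
      rw [ν.tubeFr_circlePoint]
      change mfderiv (𝓡 4) (𝓡 (4 + 1)) (P.upEmbI ι hιr) (P.sphereEmb ι hι hιr (circlePoint θ)) (ν.tD θ (CircleNbhd.dirVec i')) = _
      -- `D(ι'♭) ∘ D(tubeMap) = D(ι'♭ ∘ tubeMap) = D(boxMapI ∘ H₀) = D(boxMapI) ∘ D(H₀)`
      have h1 : mfderiv 𝓘(ℝ, ℝ × (𝔼 3)) (𝓡 (4 + 1)) (P.upEmbI ι hιr ∘ ν.tubeMap) (θ, 0) =
          (mfderiv (𝓡 4) (𝓡 (4 + 1)) (P.upEmbI ι hιr) (ν.tubeMap (θ, 0))).comp (ν.tD θ) :=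
        mfderiv_comp (θ, (0 : 𝔼 3)) ((P.contMDiff_upEmbI ι hι hιr _).mdifferentiableAt hn)
          (ν.contMDiff_tubeMap.mdifferentiableAt hn)
      have h2 : mfderiv 𝓘(ℝ, ℝ × (𝔼 3)) (𝓡 (4 + 1)) (P.boxMapI ∘ P.H0) (θ, 0) =
          (mfderiv (𝓡 (4 + 1)) (𝓡 (4 + 1)) P.boxMapI (P.H0 (θ, 0))).comp
            (mfderiv 𝓘(ℝ, ℝ × (𝔼 3)) (𝓡 (4 + 1)) P.H0 (θ, 0)) :=
        mfderiv_comp (θ, (0 : 𝔼 3)) (P.mdifferentiableAt_boxMapI hw₀) (P.mdifferentiableAt_H0 θ)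
      rw [P.upEmbI_comp_tubeMap ι hι hιr] at h1
      rw [hpt]
      have := congrArg (fun T : (ℝ × (𝔼 3)) →L[ℝ] 𝔼 (4 + 1) => T (CircleNbhd.dirVec i')) (h1.symm.trans h2)
      exact this
    · change (ν.tubeFr (circlePoint θ) i').2 = CircleNbhd.dirR i'
      rw [ν.tubeFr_circlePoint]; rfl

include hι hιr in
/-- The constant box frame is a frame. [folklore] -/
theorem linearIndependent_boxFr₀ : LinearIndependent ℝ P.boxFr₀ := by
  have hF := (P.isStableFrameFieldOn_liftedTubeFr ι hι hιr).2.2 (circlePoint 0) (mem_univ _)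
  rw [P.liftedTubeFr_circlePoint ι hι hιr 0, pushFr_eq, boxFr_eq_rotFrame, rotFrame_eq] at hF
  exact (hF.of_comp _).of_comp _

/-! #### The core disc -/

/-- The flat core disc `x ↦ (ε x, 0)` in box coordinates. [cite: MilnorHCobordism1965, proof of Thm. 3.13] -/
def coreDisc₀ : C(𝔻², 𝔼 (4 + 1)) :=
  ⟨fun x => lowerEmb (1 + 1) (4 + 1) (P.ε • (x : EuclideanSpace ℝ (Fin (1 + 1)))),
    (lowerEmb (1 + 1) (4 + 1)).continuous.comp (continuous_subtype_val.const_smul P.ε)⟩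

/-- The flat core disc lies in the box domain. [folklore] -/
theorem coreDisc₀_mem_boxDom (x : 𝔻²) : P.coreDisc₀ x ∈ P.boxDom := by
  have hε := P.eps_pos
  have hx : ‖(x : EuclideanSpace ℝ (Fin (1 + 1)))‖ ≤ 1 := mem_closedBall_zero_iff.mp x.2
  have hnorm : ‖P.ε • (x : EuclideanSpace ℝ (Fin (1 + 1)))‖ ≤ P.ε := by
    rw [norm_smul, Real.norm_of_nonneg hε.le]; nlinarith
  have h3 : ‖P.ε • (x : EuclideanSpace ℝ (Fin (1 + 1)))‖ ≤ 3 * P.ε := by linarith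
  rw [boxDom, Set.mem_inter_iff, mem_ball_zero_iff, Set.mem_setOf_eq]
  refine ⟨?_, ?_⟩
  · change ‖lowerEmb (1 + 1) (4 + 1) (P.ε • (x : EuclideanSpace ℝ (Fin (1 + 1))))‖ < 3 * P.ε
    rw [norm_lowerEmb P.succ_le]; linarith
  · change f (P.chartPoint (lowerEmb (1 + 1) (4 + 1) (P.ε • (x : EuclideanSpace ℝ (Fin (1 + 1)))))) ∈ Ioo (0 : ℝ) 1
    rw [P.apply_chartPoint_lowerEmb h3]
    have hsq : ‖P.ε • (x : EuclideanSpace ℝ (Fin (1 + 1)))‖ ^ 2 ≤ P.ε ^ 2 := pow_le_pow_left₀ (norm_nonneg _) hnorm 2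
    have hb' : P.b' = f P.q - P.ε ^ 2 := rfl
    constructor
    · have := P.pre.pos.trans P.a₀_lt_b'; rw [hb'] at this; linarith
    · have := P.apply_le.trans_lt P.pre.lt_one; nlinarith [norm_nonneg (P.ε • (x : EuclideanSpace ℝ (Fin (1 + 1))))]

/-- **The core disc** `K = ψ(flat disc)` in `W♭` (the stable disc of `q` in the box, a disc bounding
the attaching circle at the level `b'`). [cite: MilnorHCobordism1965, proof of Thm. 3.13; Kirby1989, Ch. X p. 55] -/
def coreDisc : C(𝔻², Wb c) :=
  ⟨P.boxMapI ∘ P.coreDisc₀,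
    P.contMDiffOn_boxMapI.continuousOn.comp_continuous P.coreDisc₀.continuous P.coreDisc₀_mem_boxDom⟩

/-- The boundary of the flat core disc is the box circle `w₀`. [folklore] -/
theorem coreDisc₀_bd_circlePoint (θ : ℝ) : P.coreDisc₀ (bd (circlePoint θ)) = P.H0 (θ, 0) := by
  rw [H0_zero]; rfl

/-- **The lifted disc** `ι'♭ ∘ D` of a disc `D` in the level. [folklore] -/
def upDisc (D : C(𝔻², V)) : C(𝔻², Wb c) :=
  ⟨P.upEmbI ι hιr ∘ D, (P.contMDiff_upEmbI ι hι hιr).continuous.comp D.2⟩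

/-- **The lifted disc and the core disc have the same boundary circle** (the attaching circle at
the level `b'`). [folklore] -/
theorem upDisc_bd (D : C(𝔻², V)) (hD : ∀ u, D (bd u) = P.sphereEmb ι hι hιr u) (u : 𝕊¹) :
    P.upDisc ι hι hιr D (bd u) = P.coreDisc (bd u) := by
  apply InteriorManifold.ext
  change P.upEmb ι (D (bd u)) = (P.boxMapI (P.coreDisc₀ (bd u))).val
  rw [hD, P.upEmb_sphereEmb ι hι hιr, P.boxMapI_val (P.coreDisc₀_mem_boxDom _), paramVec_zero]
  rfl

/-- **The sphere `T_D = (ι'♭ ∘ D) ∪ K`** of a disc `D` in the level bounding the attaching circle: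
the lifted disc glued to the core disc along the attaching circle. [cite: Kirby1989, Ch. X p. 55] -/
def sphereOfDisc (D : C(𝔻², V)) (hD : ∀ u, D (bd u) = P.sphereEmb ι hι hιr u) : C(𝕊², Wb c) :=
  glue (P.upDisc ι hι hιr D) P.coreDisc (P.upDisc_bd ι hι hιr D hD)

/-- **The class of the lifted tube frame over the core disc is the universal rotation class.**
[cite: Kirby1989, Ch. X p. 55] -/
theorem eClass_coreDisc :
    eClass P.coreDisc (P.liftedTubeFr ι hι hιr)
      ((P.isStableFrameFieldOn_liftedTubeFr ι hι hιr).congr_map fun u _ => by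
        obtain ⟨θ, rfl⟩ := circlePoint_surjective u
        change P.coreDisc (bd (circlePoint θ)) = P.upEmbI ι hιr (P.sphereEmb ι hι hιr (circlePoint θ))
        apply InteriorManifold.ext
        change (P.boxMapI (P.coreDisc₀ (bd (circlePoint θ)))).val = P.upEmb ι (P.sphereEmb ι hι hιr (circlePoint θ))
        rw [P.boxMapI_val (P.coreDisc₀_mem_boxDom _), P.upEmb_sphereEmb ι hι hιr, paramVec_zero]; rfl) =
      rotClass two_le_five := by
  -- the box frame over the core disc
  have hG : IsStableFrameFieldOn P.coreDisc (fun x => pushFr P.boxMapI (P.coreDisc₀ x) (stdB (4 + 1))) univ :=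
    P.isStableFrameFieldOn_boxFrame P.coreDisc₀.continuous (fun x _ => P.coreDisc₀_mem_boxDom x)
  rw [eClass_eq (by norm_num) _ hG]
  refine clsGL_eq_rotClass two_le_five (by norm_num) (P.linearIndependent_boxFr₀ ι hι hιr) _ fun u => ?_
  obtain ⟨θ, rfl⟩ := circlePoint_surjective u
  rw [compLoopGL_apply_val]
  change compMat (P.liftedTubeFr ι hι hιr (circlePoint θ)) (pushFr P.boxMapI (P.coreDisc₀ (bd (circlePoint θ))) (stdB (4 + 1))) = _
  rw [P.liftedTubeFr_circlePoint ι hι hιr, coreDisc₀_bd_circlePoint, compMat_pushFr (P.mfderiv_boxMapI_injective (P.H0_mem_boxDom _))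
    (stdB (4 + 1)).linearIndependent, boxFr_eq_rotFrame]

/-- **Main theorem (F3). The framing class of the attaching circle of a critical point of index
`2` in a `5`-dimensional cobordism, relative to a disc `D` bounding it in the level, is the
universal class `rotClass` if and only if the stable tangent bundle of the interior of the
cobordism is framed along the sphere `T_D = (ι' ∘ D) ∪ (core disc)`.** This is the elementary
content of Kirby's *"the framing is zero in `π₁(SO(3)) = ℤ/2` because `W` is spin"* (Ch. X p. 55):
for a spin (or merely `w₂ = 0` on spherical classes) cobordism every such sphere is framed.
[cite: Kirby1989, Ch. X p. 55; GompfStipsiczGSM1999, §5.2, Prop. 5.7.x (framings and `w₂`)] -/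
theorem ob_eq_rotClass_iff (D : C(𝔻², V)) (hD : ∀ u, D (bd u) = P.sphereEmb ι hι hιr u) :
    (P.circleNbhd ι hι hιr).ob D hD = rotClass two_le_five ↔
      HasStableTangentFramingAlong (𝓡 (4 + 1)) (Wb c) (P.sphereOfDisc ι hι hιr D hD) := by
  set ν := P.circleNbhd ι hι hιr with hν
  -- the tube frame along `D ∘ bd`
  have hF : IsStableFrameFieldOn (D ∘ bd) ν.tubeFr univ := ν.isStableFrameFieldOn_tubeFr.congr_map fun u _ => hD u
  -- `ob = e_V(tubeFr, D) = e_W(lift, ι'♭ ∘ D)`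
  have hlift := eClass_lift (P.upEmbI ι hιr) (P.xiV ι) (by norm_num)
    ((P.contMDiff_upEmbI ι hι hιr).of_le (by simp)) (P.mfderiv_upEmbI_injective ι hι hιr)
    (P.continuous_fldI_upEmbI ι hι hιr) (P.fldI_not_mem_range ι hι hιr) (D := D) hF
  have hob : ν.ob D hD = eClass (P.upDisc ι hι hιr D) (P.liftedTubeFr ι hι hιr)
      ((P.isStableFrameFieldOn_liftedTubeFr ι hι hιr).congr_map fun u _ => by
        change P.upEmbI ι hιr (D (bd u)) = P.upEmbI ι hιr (P.sphereEmb ι hι hιr u); rw [hD]) := by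
    unfold CircleNbhd.ob
    rw [← hlift]
    refine eClass_congr _ _ fun u => ?_
    simp only [liftedTubeFr, liftField, Function.comp_apply]
    rw [hD u]
  rw [hob, sphereOfDisc, framed_glue_iff (by norm_num), P.eClass_coreDisc ι hι hιr]

end Assembly

end PassageSetting

end Cobordism

end Literature.Topology.FourManifolds
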